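import Summits.BirchSwinnertonDyer.BirchSwinnertonDyer.Theorems.GenusKolyvaginAtTwoEquivariantKolyvaginExactAtTwoLocalTorsionCount
import Literature.NumberTheory.EllipticCurves.Gross2004.RationalCharacterHeckeValuesProofs
import Literature.NumberTheory.EllipticCurves.TwoAdicImageSurjectivityModTwoProofs
import Literature.NumberTheory.EllipticCurves.SelmerCorankControlRatProofs
import Literature.NumberTheory.GaloisRepresentations.HeckeCharacterProofs
import HarnessLib

/-!
# Route ByReductionTypeAtTwo, crux `RankOneAtTwoBigImageOddLocal` (stmt-BirchSwinnertonDyer-23715), LINE v8.8 `one_door_analytic`: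
# the LOCAL COUNT at a TRANSPOSITION PRIME — `(Δ_min/q₀) = −1 ⟹ #E(ℚ_{q₀})[2] = 2`

Width prover seat `bsd-line-fkl-p2` g10 (2026-08-28), `--supports stmt-BirchSwinnertonDyer-23715` (helper).  THEOREMS ONLY (no
definition, no named fact, no `sorry`).  BSD is not proved by any of this.

The door carriers of the line count the primes of `d_K` by the Legendre symbol of the minimal discriminant: `transpCount W d =
#{q ∣ d : (Δ_min/q) = −1}` (`…OneDoorLawDefs.lean`).  The local leaves of the bottom rung at the error place `q₀` of a MINIMAL door
(`…OneDoorBottomLocalLines.lean`: `hline_at_of_card`; the twin's line; Kramer's norm index) are stated from the COUNT `#E(ℚ_{q₀})[2] = 2`.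
This file is the dictionary between the two currencies:

* §1 `card_fixedPoints_perm_three_of_sign_eq_neg_one` — an odd permutation of three letters fixes exactly one (fact-free, `decide`);
* §2 `natCard_fixed_geomTorsion_two_eq` — for `σ ∈ Γ_K` the fixed points of `σ` on `E[2] = {O, T₀, T₁, T₂}` are `O` and the fixed
  letters of `permGal σ` (Dokchitser–Dokchitser bookkeeping, tree `TwoTorsionGaloisActionProofs`): `#E[2]^σ = 1 + #Fix(permGal σ)`;
* §3 `sign_permGal_eq_legendreSym_of_isArithFrobAt` — over `ℚ`: an arithmetic Frobenius `σ` at a prime above an odd good `q ∤ Δ` acts on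
  `δ = √(Δ/16)` by `sign(permGal σ)` (`smul_delta`) AND by the Legendre symbol `(Δ/q)` (Euler's criterion,
  `Gross2004.smul_sqrt_eq_legendreSym_pow_mul_of_isArithFrobAt` with `N(v) = q`), so `sign(permGal σ) = (Δ/q)`;
* §4 `natCard_ker_zsmul_adicCompletion_two_eq_two_of_jacobiSym` — **`(Δ/q₀) = −1 ⟹ #E(ℚ_{q₀})[2] = 2`** for a globally minimal `W/ℚ`
  and an odd good prime `q₀` (`#E(ℚ_v)[2] = #E[2]^{Φ}`, `ReductionCyclic.natCard_ker_zsmul_adicCompletion_eq`, file `…LocalTorsionCount`), also in the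
  `nsmulAddMonoidHom 2` form consumed by `hline_at_of_card` / `hrec_at_of_card`.

References: [Kramer1981] Prop. 3 and p. 125; [MazurRubin2010] Lemma 2.2 (i); [DokchitserDokchitserMathZ2012] proof of the Theorem
(`ℚ(E[2]) ⊇ ℚ(√Δ)`); [IrelandRosen1990] Prop. 5.1.2, 13.1.3; [SilvermanAEC2009] VII.4.1.
-/

set_option autoImplicit false
-- the Theorems namespace of this sub repeats the summit name by design (D-0017 nested layout)
set_option linter.dupNamespace false

noncomputable section

open scoped Classical

namespace Summit.BirchSwinnertonDyer.BirchSwinnertonDyer.Theorems.RankOneAtTwoOneDoor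

open WeierstrassCurve NumberField IsDedekindDomain Field Rat.HeightOneSpectrum
open Literature.NumberTheory.EllipticCurves Literature.NumberTheory.GaloisRepresentations
open Literature.NumberTheory.EllipticCurves.DokchitserDokchitser2012
open Summit.BirchSwinnertonDyer.BirchSwinnertonDyer.Theorems.GenusExact

/-! ## §1 An odd permutation of three letters fixes exactly one letter -/

/-- **Fact-free**: a permutation of `Fin 3` of sign `−1` is a transposition, so it fixes exactly one letter. [folklore] -/
theorem card_fixedPoints_perm_three_of_sign_eq_neg_one (g : Equiv.Perm (Fin 3)) (hg : Equiv.Perm.sign g = -1) :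
    Fintype.card {i : Fin 3 // g i = i} = 1 := by
  revert hg
  revert g
  decide

/-! ## §2 Fixed points of `σ` on `E[2]`: `O` and the fixed letters -/

section Fixed

variable {K : Type} [Field K] (W : WeierstrassCurve K) [W.IsElliptic] (h2 : (2 : K) ≠ 0)

/-- **`#E[2]^σ = #Fix(permGal σ) + 1`**: the points of `E[2] = {O, T₀, T₁, T₂}` fixed by `σ ∈ Γ_K` are `O` and the `T_i` with
`permGal σ i = i` (`σ T_i = T_{permGal σ i}`). [cite: SilvermanAEC2009, III.§7] -/
theorem natCard_fixed_geomTorsion_two_eq (σ : absoluteGaloisGroup K) :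
    Nat.card {P : geomTorsion W 2 // σ • P = P} = Nat.card {i : Fin 3 // permGal W h2 σ i = i} + 1 := by
  classical
  have hT0 : ∀ i : Fin 3, T W h2 i ≠ 0 := fun i h => coe_T_ne_zero W h2 i (by rw [h]; rfl)
  -- the bijection `Option (fixed letters) ≃ fixed points`
  let f : Option {i : Fin 3 // permGal W h2 σ i = i} → {P : geomTorsion W 2 // σ • P = P} := fun o =>
    match o with
    | none => ⟨0, smul_zero σ⟩
    | some i => ⟨T W h2 i.1, by rw [← T_permGal, i.2]⟩
  have hf : Function.Bijective f := by
    constructor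
    · rintro (_ | ⟨i, hi⟩) (_ | ⟨j, hj⟩) h
      · rfl
      · exact absurd (congrArg Subtype.val h).symm (hT0 j)
      · exact absurd (congrArg Subtype.val h) (hT0 i)
      · have hij : T W h2 i = T W h2 j := congrArg Subtype.val h
        have := T_injective W h2 hij
        subst this
        rfl
    · rintro ⟨P, hP⟩
      rcases eq_zero_or_eq_T W h2 P with rfl | ⟨i, rfl⟩
      · exact ⟨none, rfl⟩
      · refine ⟨some ⟨i, ?_⟩, rfl⟩
        apply T_injective W h2
        rw [T_permGal]
        exact hP
  rw [← Nat.card_eq_of_bijective f hf]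
  simp only [Nat.card_eq_fintype_card, Fintype.card_option]

end Fixed

/-! ## §3 Over `ℚ`: the sign of Frobenius on `E[2]` is the Legendre symbol of the discriminant -/

section Rat

variable (W : WeierstrassCurve ℚ) [W.IsElliptic]

/-- **`sign(permGal σ) = (Δ_min/q)` for an arithmetic Frobenius `σ` at a prime above an odd `q ∤ Δ_min`** (`W/ℚ` with integral
discriminant `Δ = Δ_min`): `δ = (x₀−x₁)(x₀−x₂)(x₁−x₂)` has `16δ² = Δ` (`algebraMap_Δ`), `σδ = sign(permGal σ)·δ` (`smul_delta`), and
`σ(4δ) = (Δ/q)·(4δ)` by Euler's criterion (`Gross2004.smul_sqrt_eq_legendreSym_pow_mul_of_isArithFrobAt`, `N(v) = q` over `ℚ`).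
[cite: DokchitserDokchitserMathZ2012, Theorem (1), proof] [cite: IrelandRosen1990, Prop. 5.1.2 and 13.1.3] -/
theorem sign_permGal_eq_legendreSym_of_isArithFrobAt {D : ℤ} (hΔ : W.Δ = (D : ℚ))
    {q : ℕ} [Fact q.Prime] (hq2 : q ≠ 2) (hqΔ : ¬ (q : ℤ) ∣ D)
    {v : HeightOneSpectrum (𝓞 ℚ)} (hqv : (q : 𝓞 ℚ) ∈ v.asIdeal)
    {𝔓 : Ideal (absIntegers (𝓞 ℚ) ℚ)} (h𝔓 : 𝔓 ∈ v.primesAbove)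
    {σ : absoluteGaloisGroup ℚ} (hσ : IsArithFrobAt (𝓞 ℚ) σ 𝔓) :
    ((Equiv.Perm.sign (permGal W (two_ne_zero : (2 : ℚ) ≠ 0) σ) : ℤ) : ℚ) = legendreSym q D := by
  have hq : q.Prime := Fact.out
  -- `r = 4δ`, `r² = Δ = D`
  set r : AlgebraicClosure ℚ := 4 * delta W (two_ne_zero : (2 : ℚ) ≠ 0) with hr
  have hr2 : r ^ 2 = (D : AlgebraicClosure ℚ) := by
    have h := algebraMap_Δ W (two_ne_zero : (2 : ℚ) ≠ 0)
    rw [hΔ, map_intCast] at h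
    rw [hr, mul_pow, h]; norm_num
  -- `N(v) = q`
  have hN : v.residueCard = q ^ 1 := by
    rw [pow_one, Literature.NumberTheory.GaloisRepresentations.Rat.residueCard_eq_natGenerator v,
      natGenerator_eq_of_natCast_mem v hq hqv]
  -- Euler: `σ r = (D/q) r`
  have h1 := Gross2004.smul_sqrt_eq_legendreSym_pow_mul_of_isArithFrobAt (K := ℚ) hq2 hqv hN hqΔ hr2 h𝔓 hσ
  rw [pow_one] at h1
  -- Dokchitser–Dokchitser: `σ r = sign(permGal σ) r`
  have h2' : σ • r = ((Equiv.Perm.sign (permGal W (two_ne_zero : (2 : ℚ) ≠ 0) σ) : ℤ) : AlgebraicClosure ℚ) * r := by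
    rw [hr, smul_mul', smul_delta]
    have h4 : σ • (4 : AlgebraicClosure ℚ) = 4 :=
      map_ofNat (MulSemiringAction.toRingHom (absoluteGaloisGroup ℚ) (AlgebraicClosure ℚ) σ) 4
    rw [h4]; ring
  have hr0 : r ≠ 0 := mul_ne_zero (by norm_num) (delta_ne_zero W (two_ne_zero : (2 : ℚ) ≠ 0))
  have heq : ((Equiv.Perm.sign (permGal W (two_ne_zero : (2 : ℚ) ≠ 0) σ) : ℤ) : AlgebraicClosure ℚ) =
      ((legendreSym q D : ℤ) : AlgebraicClosure ℚ) :=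
    mul_right_cancel₀ hr0 (h2'.symm.trans h1)
  have heqZ : (Equiv.Perm.sign (permGal W (two_ne_zero : (2 : ℚ) ≠ 0) σ) : ℤ) = legendreSym q D := by exact_mod_cast heq
  exact_mod_cast heqZ

/-! ## §4 `(Δ_min/q₀) = −1 ⟹ #E(ℚ_{q₀})[2] = 2` -/

/-- **The local count at a TRANSPOSITION prime.**  `W/ℚ` globally minimal (so `Δ = Δ_min ∈ ℤ`, `Δ = Δ.num`), `q₀` an odd prime of good
reduction with `q₀ ∤ Δ_min` and `(Δ_min/q₀) = −1`, `v` its place.  THEN `#E(ℚ_v)[2] = 2`: `#E(ℚ_v)[2] = #E[2]^{Φ}` for an arithmetic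
Frobenius `Φ` at the prime of `ℚ_v` (good reduction, `q₀ ∤ 2`; `ReductionCyclic.natCard_ker_zsmul_adicCompletion_eq`), `Φ` is an ODD
permutation of `{T₀, T₁, T₂}` (§3), hence a transposition fixing exactly one letter (§1), so `E[2]^{Φ} = {O, T}` (§2).  This is the count
`dim E(ℚ_{q₀})[2] = 1` of Mazur–Rubin's Lemma 2.2 (i) / Kramer's Prop. 3 at the transposition prime of a door.
[cite: Kramer1981, Prop. 3] [cite: MazurRubin2010, Lemma 2.2 (i)] [cite: SilvermanAEC2009, Prop. VII.4.1] -/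
theorem natCard_ker_zsmul_adicCompletion_two_eq_two_of_jacobiSym [W.IsGloballyMinimal]
    {q₀ : ℕ} [Fact q₀.Prime] (hq₀2 : q₀ ≠ 2) (hgood : W.HasGoodReductionAtPrime q₀) (hqΔ : ¬ (q₀ : ℤ) ∣ W.Δ.num)
    (hjac : jacobiSym W.Δ.num q₀ = -1) {v : HeightOneSpectrum (𝓞 ℚ)} (hv : (q₀ : 𝓞 ℚ) ∈ v.asIdeal) :
    Nat.card (zsmulAddGroupHom (2 : ℤ) : (W.baseChange (v.adicCompletion ℚ)).toAffine.Point →+ _).ker = 2 := by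
  haveI : Fact (Nat.Prime 2) := ⟨Nat.prime_two⟩
  have hq₀ : q₀.Prime := Fact.out
  have hvq : (Rat.HeightOneSpectrum.primesEquiv v : ℕ) = q₀ := primesEquiv_eq_of_natCast_mem hq₀ hv
  have hgoodv : W.HasGoodReductionAt v := (hasGoodReductionAtPrime_primesEquiv_iff_holds W v q₀ hvq).mp hgood
  have hnv : (((2 : ℤ)) : 𝓞 ℚ) ∉ v.asIdeal := by
    intro hmem
    have h2 : ((2 : ℕ) : 𝓞 ℚ) ∈ v.asIdeal := by exact_mod_cast hmem
    exact hq₀2 (hvq.symm.trans (primesEquiv_eq_of_natCast_mem Nat.prime_two h2))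
  -- an arithmetic Frobenius AT the prime of `ℚ_v`
  obtain ⟨σ₀, 𝔓₀', h𝔓₀', hσ₀, -⟩ :=
    Summit.BirchSwinnertonDyer.Rank1Residual.GaloisImage.FrobShape.exists_frobenius_natCard_fixed_eq W 2 q₀ hq₀2 hgood hv
  have h𝔓₀ := adicCompletionPrime_mem_primesAbove ℚ v
  obtain ⟨g, hg⟩ := HeightOneSpectrum.exists_smul_eq_of_mem_primesAbove_holds h𝔓₀' h𝔓₀
  have hΦ : IsArithFrobAt (𝓞 ℚ) (g * σ₀ * g⁻¹) (adicCompletionPrime ℚ v) := hg ▸ hσ₀.conj g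
  rw [ReductionCyclic.natCard_ker_zsmul_adicCompletion_eq W two_ne_zero hgoodv hnv hΦ]
  -- the discriminant is the integer `Δ.num`
  have hΔ : W.Δ = (W.Δ.num : ℚ) := by
    have hnum : W.Δ.num = minimalDiscriminantInt W := by rw [← cast_minimalDiscriminantInt W, Rat.num_intCast]
    rw [hnum, cast_minimalDiscriminantInt]
  -- `Φ` is odd on the letters
  have hsignQ := sign_permGal_eq_legendreSym_of_isArithFrobAt W hΔ hq₀2 hqΔ hv h𝔓₀ hΦ
  have hleg : legendreSym q₀ W.Δ.num = -1 := by rw [jacobiSym.legendreSym.to_jacobiSym]; exact hjac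
  have hsign : Equiv.Perm.sign (permGal W (two_ne_zero : (2 : ℚ) ≠ 0) (g * σ₀ * g⁻¹)) = -1 := by
    rw [hleg] at hsignQ
    rcases Int.units_eq_one_or (Equiv.Perm.sign (permGal W (two_ne_zero : (2 : ℚ) ≠ 0) (g * σ₀ * g⁻¹))) with h | h
    · rw [h] at hsignQ; norm_num at hsignQ
    · exact h
  -- count: `1 + 1`
  rw [natCard_fixed_geomTorsion_two_eq W (two_ne_zero : (2 : ℚ) ≠ 0), Nat.card_eq_fintype_card,
    card_fixedPoints_perm_three_of_sign_eq_neg_one _ hsign]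

/-- The same count in the currency of the local leaves (`nsmulAddMonoidHom 2`, literal `2`), ready for `hline_at_of_card` /
`hrec_at_of_card` / `mem_torsionLocalKer_of_relaxed_rat_two_of_card`. [cite: Kramer1981, Prop. 3] [cite: MazurRubin2010, Lemma 2.2 (i)] -/
theorem natCard_ker_nsmul_adicCompletion_two_eq_two_of_jacobiSym [W.IsGloballyMinimal]
    {q₀ : ℕ} [Fact q₀.Prime] (hq₀2 : q₀ ≠ 2) (hgood : W.HasGoodReductionAtPrime q₀) (hqΔ : ¬ (q₀ : ℤ) ∣ W.Δ.num)
    (hjac : jacobiSym W.Δ.num q₀ = -1) {v : HeightOneSpectrum (𝓞 ℚ)} (hv : (q₀ : 𝓞 ℚ) ∈ v.asIdeal) :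
    Nat.card (nsmulAddMonoidHom 2 : (W.baseChange (v.adicCompletion ℚ)).toAffine.Point →+ _).ker = 2 := by
  have h := natCard_ker_zsmul_adicCompletion_two_eq_two_of_jacobiSym W hq₀2 hgood hqΔ hjac hv
  have he : (zsmulAddGroupHom (2 : ℤ) : (W.baseChange (v.adicCompletion ℚ)).toAffine.Point →+ _) = nsmulAddMonoidHom 2 :=
    AddMonoidHom.ext fun a => natCast_zsmul a 2
  rw [he] at h
  exact h

end Rat

end Summit.BirchSwinnertonDyer.BirchSwinnertonDyer.Theorems.RankOneAtTwoOneDoor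

end
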